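import Literature.NumberTheory.EllipticCurves.RationalPointInfiniteOrderCriteria
import Literature.NumberTheory.EllipticCurves.QuadraticTwistRank
import Literature.NumberTheory.EllipticCurves.CyclotomicZpExtensionLayerOneSqrtTwoProofs
import Literature.NumberTheory.EllipticCurves.BSDInvariantsProofs
import Literature.NumberTheory.EllipticCurves.MordellWeilTheoremProofs
import HarnessLib

/-!
# T-42-mult in the kernel, XI: RANK CERTIFICATES for the rank-aware GV-mult anchors — the displayed
# binder `hrankA : ∀ κ, κ.IsCyclotomic → m ≤ rank_ℤ A(ℚ_k)` DISCHARGED from ONE rational point with an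
# odd prime in its denominator (`m = 1`, any layer) and, at `m = 2`, `k = 1`, one more such point on a
# global minimal model of the quadratic twist `A^{(2)}` (`ℚ_1 = ℚ(√2)`)

Cell `bsd-2adic` (run/shared/lean/pub/bsd-2adic/), seat `bsd-2adic-t42` (BRIEF-T42), GEN 8. HONEST FRAMING:
research route; THEOREMS ONLY (no `def`, no new named fact, net debt `0`); nothing booked; BSD is not proved by
any of this. PARTITION: X5@2 multiplicative (K4ᵐ, RESIDUAL-MAP B1·O1; the 25 RANK-AWARE rows of tranche 1,
HOME/t42/DESIGN-T42-ADDENDUM-8.md A8.5) × p = 2 — types-the-object-of; bears_on K4 items 19922 / 19923.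

WHY. The rank-aware anchor feed `O1.anchor_invariants_of_prop514_rank_{nonsplit,split}` pins
`λ(X(A/ℚ_∞)) = m` from K11 + `λ_an(A) = m + δ_A` (certificate) and the LOWER bound
`hrankA : ∀ κ : ZpExtension ℚ 2, κ.IsCyclotomic → m ≤ (A.baseChange (κ.layer k)).mordellWeilRank`
(= the cell's typed certificate shape `Iwasawa.LayerRankGEAt A 2 k m`, consumed through Greenberg's Thm. 1.9,
a tree theorem). GEN 7 displayed `hrankA` as a RECORD binder (Cremona `allgens`); planner 2026-08-27T06:21:15Z (3)
asked which species it is. ANSWER OF THIS FILE: it is ALGEBRAIC and KERNEL-DECIDABLE from explicit points, by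
tree theorems only —
* `not_isOfFinAddOrder_of_dvd_den` (kind `NL`: on a global minimal model a rational point whose
  `x`-coordinate has an odd prime in its denominator has infinite order — Silverman AEC VII.3.4 / IV.6.1,
  proved in the tree) and the Mordell–Weil theorem over number fields (`module_finite_point_holds`, AEC VIII.6.7,
  proved in the tree);
* injectivity of `E(ℚ) → E(K)` (Mathlib `Point.map_injective`);
* `rank E(K) = rank E(ℚ) + rank E^{(c)}(ℚ)` for `K = ℚ(θ)`, `θ² = c`, `θ ∉ ℚ` (AEC Exercise 10.16, tree
  theorem `lift_rank_point_baseChange_quadratic`) and `√2 ∈ ℚ_1` for every cyclotomic `κ : ZpExtension ℚ 2`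
  (`ZpExtension.IsCyclotomic.exists_sq_eq_two_layer_one`, `[ℚ_1 : ℚ] = 2` by `finrank_layer_holds`);
* invariance of the rank under admissible changes of variables (`mordellWeilRank_variableChange_holds`).

STATEMENTS.
* §1 `mordellWeilRank_le_mordellWeilRank_baseChange` — `rank_ℤ E(F) ≤ rank_ℤ E(K)` along a field extension
  with `E(K)` finitely generated; `one_le_mordellWeilRank_baseChange_of_dvd_den` — `1 ≤ rank_ℤ E(K)` for EVERY number field `K` from an
  `NL` point of `E(ℚ)`; `layerRank_one_of_dvd_den` — hence `∀ κ, κ.IsCyclotomic → 1 ≤ rank_ℤ E(κ.layer k)` for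
  every `k` and every prime `ℓ` of the tower (the `m = 1` rows: anchors `322d1`, `322d2`, `574h1`, `1170i2`,
  `1246h1`, `4382a1`, `5986b1`, `10718b1`).
* §2 `mordellWeilRank_baseChange_eq_add_of_sq_eq` — `rank E(K) = rank E(ℚ) + rank E^{(c)}(ℚ)` as naturals for a
  quadratic number field `K ∋ θ`, `θ² = c`, `θ ∉ ℚ` (the tree's discriminant-keyed
  `mordellWeilRank_baseChange_of_finrank_eq_two_of_finite`, re-keyed on `c`);
  `two_le_mordellWeilRank_layer_one_of_dvd_den_of_twist` — `∀ κ, κ.IsCyclotomic → 2 ≤ rank_ℤ E(κ.layer 1)` at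
  `ℓ = 2` from an `NL` point of `E(ℚ)` and an `NL` point of a global minimal model `B` of `E^{(2)}`
  (`C • B = E.quadraticTwist 2`) (the `m = 2` rows: anchors `282b1`, `442b1`, `790a1`, `1442d2`, `1722m4`,
  `2310q1`, `8550w3`, `15318k3`, `23898f1`, `96902c1`).
Per-anchor instances (the points, `B`, `C`) live in the t42 class / anchors leaf files. WHAT THIS IS NOT: not an
upper bound on any rank; not a discharge of any certificate binder (`hlanA`, `hμanA`); no class closes here.

References: [SilvermanAEC2009] VII.3.4, VIII.6.7, X.§2 / Exercise 10.16, III.3.1(b); [Washington1997] §13.1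
(`ℚ_1 = ℚ(√2)`); [GreenbergLNM1716] Thm. 1.9 (consumer); [CremonaAlgorithms1997] Table 1 (the points).
-/

set_option autoImplicit false
set_option linter.dupNamespace false

noncomputable section

open scoped Classical

open Module WeierstrassCurve Literature.NumberTheory.EllipticCurves

namespace Summit.BirchSwinnertonDyer.BirchSwinnertonDyer.Theorems.MultRankCert

/-! ## §1 One `NL` point: `1 ≤ rank_ℤ E(K)` over every number field, hence on every cyclotomic layer -/

/-- **The Mordell–Weil rank does not drop under base change**: `rank_ℤ E(F) ≤ rank_ℤ E(K)` for a field
extension `K/F` with `E(K)` finitely generated — the base-change homomorphism `E(F) → E(K)` is injective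
(Mathlib `Point.map_injective`, tree `QuadraticDescent.incl_injective`), and `finrank` is monotone along
injective `ℤ`-linear maps into finite modules. Stated for a general base field `F` (so that, as for the tree's
`mordellWeilRank`, the group law on `E(F)` carries the classical decidability instance; used at `F = ℚ`).
[cite: SilvermanAEC2009, Thm. VIII.6.7] -/
theorem mordellWeilRank_le_mordellWeilRank_baseChange {F : Type} [Field F] (W : WeierstrassCurve F)
    (K : Type) [Field K] [Algebra F K] [Module.Finite ℤ (W.baseChange K).toAffine.Point] :
    W.mordellWeilRank ≤ (W.baseChange K).mordellWeilRank :=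
  LinearMap.finrank_le_finrank_of_injective
    (f := @AddMonoidHom.toIntLinearMap W.toAffine.Point (W.baseChange K).toAffine.Point inferInstance
      inferInstance (QuadraticDescent.incl K W))
    (fun _ _ hab ↦ QuadraticDescent.incl_injective (K := K) W hab)

/-- **`1 ≤ rank_ℤ E(K)` over EVERY number field `K` from one rational point with an odd prime in the
denominator of its `x`-coordinate** (`E/ℚ` globally minimal): the point has infinite order in `E(ℚ)` (kind
`NL`, AEC VII.3.4 — tree `one_le_mordellWeilRank_of_dvd_den`, with Mordell–Weil over `ℚ`), and the rank does
not drop under base change (`mordellWeilRank_le_mordellWeilRank_baseChange`).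
[cite: SilvermanAEC2009, VII.3.4 and Thm. VIII.6.7] -/
theorem one_le_mordellWeilRank_baseChange_of_dvd_den (W : WeierstrassCurve ℚ) [W.IsElliptic]
    [W.IsGloballyMinimal] (p : ℕ) [Fact p.Prime] (hp : 3 ≤ p) {x y : ℚ} (h : W.toAffine.Nonsingular x y)
    (hx : p ∣ x.den) (K : Type) [Field K] [NumberField K] : 1 ≤ (W.baseChange K).mordellWeilRank := by
  haveI : Module.Finite ℤ (W.baseChange K).toAffine.Point := (W.baseChange K).module_finite_point_holds
  exact (one_le_mordellWeilRank_of_dvd_den W p hp h hx).trans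
    (mordellWeilRank_le_mordellWeilRank_baseChange W K)

/-- **`hrankA` at `m = 1`, any layer, any prime of the tower** — `∀ κ, κ.IsCyclotomic → 1 ≤ rank_ℤ E(κ.layer k)`
from one `NL` point of `E(ℚ)` (the layer `κ.layer k` is a number field: `finiteDimensional_layer_holds`). The
cyclotomic hypothesis is idle (kept for the verbatim binder shape `Iwasawa.LayerRankGEAt`).
[cite: SilvermanAEC2009, VII.3.4 and Thm. VIII.6.7] [cite: Washington1997, §13.1] -/
theorem layerRank_one_of_dvd_den (W : WeierstrassCurve ℚ) [W.IsElliptic] [W.IsGloballyMinimal]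
    (p : ℕ) [Fact p.Prime] (hp : 3 ≤ p) {x y : ℚ} (h : W.toAffine.Nonsingular x y) (hx : p ∣ x.den)
    {ℓ : ℕ} [Fact ℓ.Prime] (k : ℕ) :
    ∀ κ : ZpExtension ℚ ℓ, κ.IsCyclotomic → 1 ≤ (W.baseChange (κ.layer k)).mordellWeilRank := by
  intro κ _
  haveI : FiniteDimensional ℚ (κ.layer k) := κ.finiteDimensional_layer_holds k
  haveI : NumberField (κ.layer k) := NumberField.of_module_finite ℚ _
  exact one_le_mordellWeilRank_baseChange_of_dvd_den W p hp h hx (κ.layer k)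

/-! ## §2 Two `NL` points (curve and `2`-twist): `2 ≤ rank_ℤ E(ℚ_1)`, `ℚ_1 = ℚ(√2)` -/

/-- `2` is not the square of a rational number (`√2` is irrational). [folklore] -/
private theorem not_exists_rat_sq_eq_two : ¬ ∃ q : ℚ, q ^ 2 = 2 := by
  rintro ⟨q, hq⟩
  have hq' : ((|q| : ℚ) : ℝ) = Real.sqrt 2 := by
    rw [Rat.cast_abs, ← Real.sqrt_sq_eq_abs, ← Rat.cast_pow, hq, Rat.cast_ofNat]
  exact irrational_sqrt_two ⟨|q|, hq'⟩

/-- **`rank_ℤ E(K) = rank_ℤ E(ℚ) + rank_ℤ E^{(c)}(ℚ)` for a quadratic number field `K = ℚ(θ)`, `θ² = c`,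
`θ ∉ ℚ`** (Silverman AEC Exercise 10.16; the tree's cardinal identity `lift_rank_point_baseChange_quadratic`
read on `Module.finrank`, `E(K)` being finitely generated by Mordell–Weil). The tree's
`mordellWeilRank_baseChange_of_finrank_eq_two_of_finite` is the same identity keyed on `d_K`; this is the
`c`-keyed form (`E^{(d_K)} ≅ E^{(c)}` is not needed). [cite: SilvermanAEC2009, Exercise 10.16 and Thm. VIII.6.7] -/
theorem mordellWeilRank_baseChange_eq_add_of_sq_eq (W : WeierstrassCurve ℚ) [W.IsElliptic] (K : Type)
    [Field K] [NumberField K] (h2 : finrank ℚ K = 2) {θ : K} {c : ℚ}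
    (hθ : θ ∉ Set.range (algebraMap ℚ K)) (hc : θ ^ 2 = algebraMap ℚ K c) :
    (W.baseChange K).mordellWeilRank = W.mordellWeilRank + (W.quadraticTwist c).mordellWeilRank := by
  haveI : Module.Finite ℤ (W.baseChange K).toAffine.Point := (W.baseChange K).module_finite_point_holds
  have hfin : Module.rank ℤ (W.baseChange K).toAffine.Point < Cardinal.aleph0 := Module.rank_lt_aleph0 ℤ _
  have h := lift_rank_point_baseChange_quadratic W h2 hθ hc
  simp only [Cardinal.lift_id] at h
  rw [h, Cardinal.add_lt_aleph0_iff] at hfin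
  unfold WeierstrassCurve.mordellWeilRank finrank
  rw [h, Cardinal.toNat_add hfin.1 hfin.2]

/-- **`hrankA` at `m = 2`, `k = 1`, `ℓ = 2`** — `∀ κ, κ.IsCyclotomic → 2 ≤ rank_ℤ E(κ.layer 1)`: the first layer of a
cyclotomic `ℤ₂`-extension of `ℚ` is a quadratic field containing `θ` with `θ² = 2`
(`ZpExtension.IsCyclotomic.exists_sq_eq_two_layer_one`, `finrank_layer_holds`), so
`rank E(ℚ_1) = rank E(ℚ) + rank E^{(2)}(ℚ)`; `rank E(ℚ) ≥ 1` from an `NL` point of `E`, and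
`rank E^{(2)}(ℚ) = rank B(ℚ) ≥ 1` from an `NL` point of a global minimal model `B` with `C • B = E^{(2)}`
(`E^{(2)} = E.quadraticTwist 2 = ⟨0, b₂/2, 0, 2b₄, 2b₆⟩` need not be integral; rank is invariant under `C`).
[cite: SilvermanAEC2009, VII.3.4, Thm. VIII.6.7, Exercise 10.16, III.3.1(b)] [cite: Washington1997, §13.1] -/
theorem two_le_mordellWeilRank_layer_one_of_dvd_den_of_twist (W : WeierstrassCurve ℚ) [W.IsElliptic]
    [W.IsGloballyMinimal] (p : ℕ) [Fact p.Prime] (hp : 3 ≤ p) {x y : ℚ} (h : W.toAffine.Nonsingular x y)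
    (hx : p ∣ x.den) (B : WeierstrassCurve ℚ) [B.IsElliptic] [B.IsGloballyMinimal] (C : VariableChange ℚ)
    (hC : C • B = W.quadraticTwist 2) (q : ℕ) [Fact q.Prime] (hq : 3 ≤ q) {x' y' : ℚ}
    (h' : B.toAffine.Nonsingular x' y') (hx' : q ∣ x'.den) :
    ∀ κ : ZpExtension ℚ 2, κ.IsCyclotomic → 2 ≤ (W.baseChange (κ.layer 1)).mordellWeilRank := by
  intro κ hκ
  haveI : FiniteDimensional ℚ (κ.layer 1) := κ.finiteDimensional_layer_holds 1
  haveI : NumberField (κ.layer 1) := NumberField.of_module_finite ℚ _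
  have h2 : finrank ℚ (κ.layer 1) = 2 := by rw [κ.finrank_layer_holds 1, pow_one]
  obtain ⟨θ, hθ2⟩ := hκ.exists_sq_eq_two_layer_one
  have hc : θ ^ 2 = algebraMap ℚ (κ.layer 1) 2 := by rw [hθ2, map_ofNat]
  have hθ : θ ∉ Set.range (algebraMap ℚ (κ.layer 1)) := by
    rintro ⟨r, rfl⟩
    apply not_exists_rat_sq_eq_two
    refine ⟨r, ?_⟩
    have e : algebraMap ℚ (κ.layer 1) (r ^ 2) = algebraMap ℚ (κ.layer 1) 2 := by rw [map_pow, hc]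
    exact (algebraMap ℚ (κ.layer 1)).injective e
  have hW : 1 ≤ W.mordellWeilRank := one_le_mordellWeilRank_of_dvd_den W p hp h hx
  have hB : 1 ≤ (W.quadraticTwist 2).mordellWeilRank := by
    have e : (C • B).mordellWeilRank = B.mordellWeilRank := mordellWeilRank_variableChange_holds B C
    rw [← hC, e]
    exact one_le_mordellWeilRank_of_dvd_den B q hq h' hx'
  have e := mordellWeilRank_baseChange_eq_add_of_sq_eq W (κ.layer 1) h2 hθ hc
  have : 2 ≤ (W.baseChange (κ.layer 1)).mordellWeilRank := by rw [e]; omega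
  convert this using 2

end Summit.BirchSwinnertonDyer.BirchSwinnertonDyer.Theorems.MultRankCert

end
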